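import Literature.NumberTheory.EllipticCurves.Kobayashi2003.SignedSelmerTorsion
import Literature.NumberTheory.EllipticCurves.IwasawaSelmerModuleFiniteProofs
import Literature.NumberTheory.EllipticCurves.IwasawaSelmerTorsionProofs
import Literature.NumberTheory.EllipticCurves.IwasawaEulerCharRankZeroProofs
import HarnessLib

/-!
# The finite-generation half of Kobayashi's Theorem 1.2, PROVED for every signed Selmer dual:
# `X^ε(E/K_∞) = Sel^ε(E/K_∞)^∨` is a finitely generated `Λ`-module

`Proofs` file (theorems only; no definition, no named fact, `#print axioms` standard) next to
`SignedSelmerTorsion.lean` (the NAMED FACT `thm12_signedSelmerDual_finite_torsion`: "The Pontryagin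
dual of the even (odd) Selmer group `Sel^±(E/F_∞)^∨` is a finitely generated torsion
`ℤ_p[[Γ]]`-module", Kobayashi, Invent. Math. 152 (2003), Thm. 1.2, p. 2, for `F = ℚ`, `p` odd, good
supersingular, `a_p = 0`). Of its two halves the FIRST — finite generation — holds for a completely
general reason and is proved here OUTRIGHT, for every number field `K`, every elliptic `E/K`, every
prime `p`, every `ℤ_p`-extension `κ` with topological generator `γ`, both signs `ε`, and every
Pontryagin-dual datum `D : SignedSelmerDualData W κ γ ε` (Def. 1.1, `SignedSelmer.lean`):

* `SignedSelmerDualData.isDualPair` — every datum is a dual pair for `ψ = conj_γ − 1` on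
  `Sel^ε(E/K_∞)` (`conjSignedSelmerInfty`, `SignedSelmerDualExistsProofs`), word for word the tree's
  `WeierstrassCurve.SelmerDualData.isDualPair`;
* `SignedSelmerDualData.moduleFinite` — **`Module.Finite (IwasawaAlgebra p) D.X`**: the tree's
  Nakayama lemma for Pontryagin duals (`IwasawaDual.IsDualPair.module_finite`, Lang Ch. 5 §1 /
  Greenberg §1 p. 60: it suffices that `S[p] ∩ ker ψ` is finite) applied to
  `S = Sel^ε(E/K_∞) ≤ Sel_{p^∞}(E/K_∞)` (`signedSelmerInfty_le_selmerInfty`), the finiteness of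
  `Sel_∞[p]^γ` being the tree theorem
  `WeierstrassCurve.finite_setOf_selmerInfty_pTorsion_conjH1_eq_of_isTopGenerator` (Greenberg's
  "`X/𝔪X` is finite", any `p`, any reduction type, any `ℤ_p`-extension);
* `SignedSelmerDualData.isTorsion_of_finite_endInvariants` — the torsion half in Greenberg's
  Thm. 1.4 / Lemma 4.2 shape: **if `Sel^ε(E/K_∞)^γ` is finite then `X^ε` is `Λ`-torsion and every
  generator `f` of `char(X^ε)` has `f(0) ≠ 0`** (`IsDualPair.exists_nsmul_eq_X_smul` +
  `isTorsion_of_forall_nsmul_eq_X_smul` + `IsDualPair.order_charGenerator_eq_zero_of_finite_endInvariants`);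
* `thm12_moduleFinite_holds` — the finite-generation clause of the named fact, in its own binder
  shape, now a theorem (the torsion clause, which is Kato's theorem through the Coleman maps,
  Kobayashi §6–§9, stays the fact's content).

Nothing about any curve's torsion-ness is asserted; nothing is booked; no class label moves.

References: [Kobayashi2003] S. Kobayashi, Invent. Math. 152 (2003), Thm. 1.2 and Def. 1.1 (p. 2);
[GreenbergLNM1716] R. Greenberg, LNM 1716 (1999), §1 p. 60 (Nakayama), p. 61 (proof of Thm. 1.4),
§4 Lemma 4.2 (p. 102); [Lang1990] S. Lang, *Cyclotomic Fields I and II*, Ch. 5 §1.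
-/

noncomputable section

open scoped Classical

open Literature.NumberTheory.EllipticCurves Literature.NumberTheory.EllipticCurves.IwasawaAlgebra
  Literature.NumberTheory.EllipticCurves.IwasawaDual WeierstrassCurve ZpExtension

universe u

namespace Literature.NumberTheory.EllipticCurves.Kobayashi2003

variable {K : Type u} [Field K] [NumberField K] (W : WeierstrassCurve K) {p : ℕ} [Fact p.Prime]
  (κ : ZpExtension K p) (ε : ℤˣ)

namespace SignedSelmerDualData

variable {W κ ε}

/-- Every Pontryagin-dual datum `D : SignedSelmerDualData W κ γ ε` of `Sel^ε(E/K_∞)` is a dual pair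
for `ψ = conj_γ − 1` (`conjSignedSelmerInfty`): `toDual_T_smul`, `toDual_C_smul`, and local
nilpotence of `(p, ψ)` for a topological generator `γ` (`isLocNil_conjSignedSelmerInfty_sub_one`) —
word for word `WeierstrassCurve.SelmerDualData.isDualPair`. [cite: Kobayashi2003, Def. 1.1 (sentence following it, p. 2)]
[cite: GreenbergLNM1716, §1 p. 60 (after Conj. 1.3)] -/
theorem isDualPair {γ : Field.absoluteGaloisGroup K} (D : SignedSelmerDualData W κ γ ε)
    (hγ : κ.IsTopGenerator γ) :
    IwasawaDual.IsDualPair p (conjSignedSelmerInfty W κ ε γ - 1) D.toDual where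
  bijective := D.bijective
  T_smul x s := by
    rw [D.toDual_T_smul, IwasawaDual.End_sub_apply, AddMonoid.End.one_apply, map_sub]
    rfl
  C_smul c x s k hk := D.toDual_C_smul c x s k hk
  locNil := isLocNil_conjSignedSelmerInfty_sub_one W κ ε hγ

/-- **`X^ε(E/K_∞)` is a finitely generated `Λ`-module — the finite-generation half of Kobayashi's
Thm. 1.2, for every number field `K`, elliptic `E/K`, prime `p`, `ℤ_p`-extension `κ` with topological
generator `γ`, sign `ε` and datum `D`.** Nakayama for duals (`IsDualPair.module_finite`) needs only
the finiteness of `Sel^ε_∞[p] ∩ ker(conj_γ − 1)`, which injects into the finite set `Sel_∞[p]^γ`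
(`finite_setOf_selmerInfty_pTorsion_conjH1_eq_of_isTopGenerator`) along
`Sel^ε(E/K_∞) ≤ Sel_{p^∞}(E/K_∞)` (`signedSelmerInfty_le_selmerInfty`).
[cite: Kobayashi2003, Thm. 1.2 (p. 2; the finite-generation clause)] [cite: GreenbergLNM1716, §1 p. 60 (after Conj. 1.3)] -/
theorem moduleFinite [W.IsElliptic] {γ : Field.absoluteGaloisGroup K} (hγ : κ.IsTopGenerator γ)
    (D : SignedSelmerDualData W κ γ ε) : Module.Finite (IwasawaAlgebra p) D.X := by
  refine (D.isDualPair hγ).module_finite ?_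
  have hfin := W.finite_setOf_selmerInfty_pTorsion_conjH1_eq_of_isTopGenerator κ hγ
  let ι : signedSelmerInfty W κ ε → W.selmerInfty κ := fun s ↦
    ⟨(s : W.subgroupH1 p κ.kerSubgroup), signedSelmerInfty_le_selmerInfty W κ ε s.2⟩
  have hι : Function.Injective ι := fun a b hab ↦ by
    have h : ((ι a : W.selmerInfty κ) : W.subgroupH1 p κ.kerSubgroup) = ι b := congrArg _ hab
    exact Subtype.ext h
  refine Set.Finite.of_finite_image (hfin.subset ?_) hι.injOn
  rintro _ ⟨s, hs, rfl⟩
  obtain ⟨hs1, hs2⟩ := IwasawaDual.mem_piece.mp hs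
  rw [pow_one] at hs1 hs2
  refine ⟨Subtype.ext ?_, ?_⟩
  · have h := congrArg Subtype.val hs1
    simpa [ι] using h
  · have h : (((conjSignedSelmerInfty W κ ε γ - 1) s : signedSelmerInfty W κ ε) :
        W.subgroupH1 p κ.kerSubgroup) = ((0 : signedSelmerInfty W κ ε) : W.subgroupH1 p κ.kerSubgroup) :=
      congrArg _ hs2
    rw [IwasawaDual.End_sub_apply, AddMonoid.End.one_apply, AddSubgroupClass.coe_sub,
      coe_conjSignedSelmerInfty_apply, ZeroMemClass.coe_zero, sub_eq_zero] at h
    exact h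

/-- **`Sel^ε(E/K_∞)^γ` finite ⟹ `X^ε(E/K_∞)` is `Λ`-torsion** (any `K`, `κ`, `γ` a topological
generator, `ε`, `D`): `N = #Sel^ε_∞^γ` kills `ker(conj_γ − 1)`, so `N · X ⊆ T · X`
(`IsDualPair.exists_nsmul_eq_X_smul`), and a finitely generated `Λ`-module with `N X ⊆ TX` is
torsion (`isTorsion_of_forall_nsmul_eq_X_smul`, Greenberg's "exercise" in the proof of Thm. 1.4).
The torsion clause of Thm. 1.2 itself (Kato + Coleman maps) is NOT proved here.
[cite: GreenbergLNM1716, §1 p. 61 (proof of Thm. 1.4)] [cite: Kobayashi2003, Thm. 1.2 (p. 2)] -/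
theorem isTorsion_of_finite_endInvariants [W.IsElliptic] {γ : Field.absoluteGaloisGroup K}
    (hγ : κ.IsTopGenerator γ) (D : SignedSelmerDualData W κ γ ε)
    (hfin : Finite (endInvariants (conjSignedSelmerInfty W κ ε γ - 1))) :
    Module.IsTorsion (IwasawaAlgebra p) D.X := by
  haveI := D.moduleFinite hγ
  have hN0 : Nat.card (endInvariants (conjSignedSelmerInfty W κ ε γ - 1)) ≠ 0 := Nat.card_pos.ne'
  refine IwasawaDual.isTorsion_of_forall_nsmul_eq_X_smul hN0 fun x ↦
    (D.isDualPair hγ).exists_nsmul_eq_X_smul ?_ x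
  intro s hs
  have hs' : s ∈ endInvariants (conjSignedSelmerInfty W κ ε γ - 1) :=
    (mem_endInvariants_iff _ s).mpr hs
  have h1 : Nat.card (endInvariants (conjSignedSelmerInfty W κ ε γ - 1)) •
      (⟨s, hs'⟩ : endInvariants (conjSignedSelmerInfty W κ ε γ - 1)) = 0 := card_nsmul_eq_zero'
  have h2 := congrArg Subtype.val h1
  simpa using h2

/-- **`Sel^ε(E/K_∞)^γ` finite ⟹ every generator `f` of `char X^ε(E/K_∞)` has `ord_T f = 0` and
`f(0) ≠ 0`** (Greenberg's Lemma 4.2 on the dual pair of the signed structure).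
[cite: GreenbergLNM1716, §4 Lemma 4.2 (p. 102)] -/
theorem order_eq_zero_and_constantCoeff_ne_zero_of_finite_endInvariants [W.IsElliptic]
    {γ : Field.absoluteGaloisGroup K} (hγ : κ.IsTopGenerator γ) (D : SignedSelmerDualData W κ γ ε)
    (hfin : Finite (endInvariants (conjSignedSelmerInfty W κ ε γ - 1)))
    {f : IwasawaAlgebra p} (hf : D.charIdeal = Ideal.span {f}) :
    f.order = 0 ∧ PowerSeries.constantCoeff f ≠ 0 := by
  haveI := D.moduleFinite hγ
  exact (D.isDualPair hγ).order_charGenerator_eq_zero_of_finite_endInvariants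
    (D.isTorsion_of_finite_endInvariants hγ hfin) f hf hfin

end SignedSelmerDualData

/-- **The finite-generation clause of the named fact `thm12_signedSelmerDual_finite_torsion`, as a
THEOREM** in the fact's own binder shape (`W/ℚ` globally minimal, `p ≠ 2`, good reduction with
`a_p = 0`, `κ` cyclotomic, `γ` a topological generator — none of which is used): for every datum
`D : SignedSelmerDualData W κ γ ε`, `Module.Finite (IwasawaAlgebra p) D.X`. The torsion clause
remains the content of the fact. [cite: Kobayashi2003, Thm. 1.2 (p. 2; the finite-generation clause)]
[cite: GreenbergLNM1716, §1 p. 60 (after Conj. 1.3)] -/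
theorem thm12_moduleFinite_holds (W : WeierstrassCurve ℚ) [W.IsElliptic] [W.IsGloballyMinimal]
    (p : ℕ) [Fact p.Prime] (_hp : p ≠ 2) (_hgood : W.HasGoodReductionAtPrime p)
    (_hap : W.frobeniusTrace p = 0) (κ : ZpExtension ℚ p) (γ : Field.absoluteGaloisGroup ℚ)
    (_hκ : κ.IsCyclotomic) (hγ : κ.IsTopGenerator γ) (ε : ℤˣ) (D : SignedSelmerDualData W κ γ ε) :
    Module.Finite (IwasawaAlgebra p) D.X :=
  D.moduleFinite hγ

/-- Hence the named fact `thm12_signedSelmerDual_finite_torsion` is EQUIVALENT to its torsion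
clause alone. [cite: Kobayashi2003, Thm. 1.2 (p. 2)] -/
theorem thm12_signedSelmerDual_finite_torsion_iff_isTorsion :
    thm12_signedSelmerDual_finite_torsion ↔
      ∀ (W : WeierstrassCurve ℚ) [W.IsElliptic] [W.IsGloballyMinimal] (p : ℕ) [Fact p.Prime],
        p ≠ 2 → W.HasGoodReductionAtPrime p → W.frobeniusTrace p = 0 →
        ∀ (κ : ZpExtension ℚ p) (γ : Field.absoluteGaloisGroup ℚ),
          κ.IsCyclotomic → κ.IsTopGenerator γ →
        ∀ (ε : ℤˣ) (D : SignedSelmerDualData W κ γ ε), Module.IsTorsion (IwasawaAlgebra p) D.X :=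
  ⟨fun h W _ _ p _ hp hgood hap κ γ hκ hγ ε D ↦ (h W p hp hgood hap κ γ hκ hγ ε D).2,
    fun h W _ _ p _ hp hgood hap κ γ hκ hγ ε D ↦
      ⟨D.moduleFinite hγ, h W p hp hgood hap κ γ hκ hγ ε D⟩⟩

end Literature.NumberTheory.EllipticCurves.Kobayashi2003

end
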